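import Mathlib
import Summits.Ventures.HodgeRepro2.T5AdicCompletionUnitIndex
import Summits.Ventures.HodgeRepro2.T5CharacterCount

/-!
# The COUNTS of Lemma N5.L4(iii) at an inert place: `(q+1)q^{n-1}` conjugate-orthogonal characters
  of conductor `≤ n`, `q` of conductor exactly `1`, `(q+1)(q-1)` of conductor exactly `2`

On the concrete pair `Kv ⊆ Lw` with `ϖ` a uniformiser of `Kv` that STAYS a uniformiser of `Lw`
(the inert case; residue fields of orders `q` and `q²`), a character `χ : Lwˣ →* ℂˣ` is
«conjugate-orthogonal of conductor `≤ n`» when it is trivial on `F_v^× = ` the image of `Kvˣ`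
and on `U_E^n = ` the image of `higherUnits ϖ n`, i.e. trivial on the subgroup
`N n := F_v^× ⊔ U_E^n`. Combining `T5AdicCompletionUnitIndex` (`[Lwˣ : N n] = (q+1)q^{n-1}`,
`[Lwˣ : N 0] = 1`) with `T5CharacterCount` (`#{χ ∣ χ|_N = 1} = [Lwˣ : N]`):

* `ncard_conjugateOrthogonal_le`: `#{χ ∣ χ|_{N n} = 1} = (q+1)·q^{n-1}` for `n ≥ 1`;
* `ncard_conjugateOrthogonal_zero`: `#{χ ∣ χ|_{N 0} = 1} = 1` (only the trivial character is
  unramified and trivial on `F_v^×` — `E_v^× = F_v^× U_E` at an inert place);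
* `ncard_conjugateOrthogonal_exact_one`: exactly `q` characters of conductor exactly `1`;
* `ncard_conjugateOrthogonal_exact_two`: exactly `(q+1)(q-1)` of conductor exactly `2`;
* `ncard_conjugateOrthogonal_exact`: in general `(q+1)q^{n-1} - (q+1)q^{n-2}` for `n ≥ 2`.

(«Conductor exactly `n`» = trivial on `U_E^n`, not on `U_E^{n-1}`; the conjugate-SYMPLECTIC
characters of N5.L4(iii) are the `μ`-twists of these, a bijection — N5.L4(ii).)

Declaration per README §8(d): «uses an L-value-free non-vanishing device: NO».
-/

namespace Summit.Ventures.HodgeRepro2.T5InertCharacterCount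

open IsDedekindDomain HeightOneSpectrum T5PrincipalUnitFiltration T5PrincipalUnitComparison
  T5AdicCompletionUnitIndex T5CharacterCount

variable {K : Type*} [Field K] [NumberField K] (v : HeightOneSpectrum (NumberField.RingOfIntegers K))
variable {L : Type*} [Field L] [NumberField L]
  (w : HeightOneSpectrum (NumberField.RingOfIntegers L))
variable [Algebra (adicCompletion K v) (adicCompletion L w)]
  [ContinuousSMul (adicCompletion K v) (adicCompletion L w)]

/-- `N n ≤ N m` for `m ≤ n` (the filtration is decreasing). -/
theorem range_sup_map_higherUnits_antitone (ϖ : adicCompletionIntegers K v) {m n : ℕ}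
    (hmn : m ≤ n) :
    (T5UnramifiedCharacter.baseUnits v w).range ⊔
      (higherUnits (algebraMap (adicCompletionIntegers K v) (adicCompletionIntegers L w) ϖ) n).map
        (Units.map (algebraMap (adicCompletionIntegers L w) (adicCompletion L w) :
          adicCompletionIntegers L w →* adicCompletion L w)) ≤
    (T5UnramifiedCharacter.baseUnits v w).range ⊔
      (higherUnits (algebraMap (adicCompletionIntegers K v) (adicCompletionIntegers L w) ϖ) m).map
        (Units.map (algebraMap (adicCompletionIntegers L w) (adicCompletion L w) :
          adicCompletionIntegers L w →* adicCompletion L w)) :=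
  sup_le_sup_left (Subgroup.map_mono (higherUnits_antitone _ hmn)) _

/-- `[Lwˣ : N 0] = 1` at an inert place: every element of `Lwˣ` is a product of an element of
`F_v^×` and a unit (`E_v^× = F_v^× U_E` when `ϖ` stays a uniformiser). -/
theorem index_range_sup_map_higherUnits_zero_of_inert {ϖ : adicCompletionIntegers K v}
    (hϖ : Irreducible ϖ)
    (hϖL : Irreducible (algebraMap (adicCompletionIntegers K v) (adicCompletionIntegers L w) ϖ)) :
    ((T5UnramifiedCharacter.baseUnits v w).range ⊔
      (higherUnits (algebraMap (adicCompletionIntegers K v) (adicCompletionIntegers L w) ϖ) 0).map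
        (Units.map (algebraMap (adicCompletionIntegers L w) (adicCompletion L w) :
          adicCompletionIntegers L w →* adicCompletion L w))).index = 1 := by
  have hϖv : Valued.v (ϖ : adicCompletion K v) = WithZero.exp (-1) :=
    (T5AdicCompletionConductor.irreducible_iff_val_eq_exp_neg_one v ϖ).mp hϖ
  have he1 : Valued.v (algebraMap (adicCompletion K v) (adicCompletion L w) (ϖ : adicCompletion K v))
      = WithZero.exp (-((1 : ℕ) : ℤ)) := by
    have h := (T5AdicCompletionConductor.irreducible_iff_val_eq_exp_neg_one w _).mp hϖL
    have h2 : algebraMap (adicCompletion K v) (adicCompletion L w)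
        (algebraMap (adicCompletionIntegers K v) (adicCompletion K v) ϖ) =
        algebraMap (adicCompletionIntegers L w) (adicCompletion L w)
          (algebraMap (adicCompletionIntegers K v) (adicCompletionIntegers L w) ϖ) := by
      rw [← IsScalarTower.algebraMap_apply, ← IsScalarTower.algebraMap_apply]
    rw [Nat.cast_one, ← h]
    exact congrArg _ h2
  rw [index_range_baseUnits_sup_map_higherUnits v w hϖv one_pos he1 _ 0, higherUnits_zero,
    sup_top_eq, Subgroup.index_top, one_mul]

section Counts

variable {ϖ : adicCompletionIntegers K v} (hϖ : Irreducible ϖ)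
  (hϖL : Irreducible (algebraMap (adicCompletionIntegers K v) (adicCompletionIntegers L w) ϖ))
  {q : ℕ} (hq : 2 ≤ q)
  (hk : Nat.card (IsLocalRing.ResidueField (adicCompletionIntegers K v)) = q)
  (hku : Nat.card (IsLocalRing.ResidueField (adicCompletionIntegers K v))ˣ = q - 1)
  (hK : Nat.card (IsLocalRing.ResidueField (adicCompletionIntegers L w)) = q ^ 2)
  (hKu : Nat.card (IsLocalRing.ResidueField (adicCompletionIntegers L w))ˣ = q ^ 2 - 1)

include hϖ hϖL hq hk hku hK hKu

/-- CONDUCTOR `≤ n`, `n ≥ 1`: exactly `(q+1)·q^{n-1}` characters `Lwˣ →* ℂˣ` trivial on `F_v^×`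
and on `U_E^n`. -/
theorem ncard_conjugateOrthogonal_le {n : ℕ} (hn : 1 ≤ n) :
    {χ : (adicCompletion L w)ˣ →* ℂˣ | ∀ y ∈ (T5UnramifiedCharacter.baseUnits v w).range ⊔
      (higherUnits (algebraMap (adicCompletionIntegers K v) (adicCompletionIntegers L w) ϖ) n).map
        (Units.map (algebraMap (adicCompletionIntegers L w) (adicCompletion L w) :
          adicCompletionIntegers L w →* adicCompletion L w)), χ y = 1}.ncard =
      (q + 1) * q ^ (n - 1) := by
  have h := index_range_baseUnits_sup_map_higherUnits_of_inert v w hϖ hϖL hn hq hk hku hK hKu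
  rw [ncard_setOf_eq_one_on _ (by rw [h]; positivity), h]

omit hq hk hku hK hKu in
/-- CONDUCTOR `0`: only the trivial character is trivial on `F_v^×` and unramified. -/
theorem ncard_conjugateOrthogonal_zero :
    {χ : (adicCompletion L w)ˣ →* ℂˣ | ∀ y ∈ (T5UnramifiedCharacter.baseUnits v w).range ⊔
      (higherUnits (algebraMap (adicCompletionIntegers K v) (adicCompletionIntegers L w) ϖ) 0).map
        (Units.map (algebraMap (adicCompletionIntegers L w) (adicCompletion L w) :
          adicCompletionIntegers L w →* adicCompletion L w)), χ y = 1}.ncard = 1 := by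
  have h := index_range_sup_map_higherUnits_zero_of_inert v w hϖ hϖL
  rw [ncard_setOf_eq_one_on _ (by rw [h]; exact one_ne_zero), h]

/-- CONDUCTOR EXACTLY `n ≥ 2`: `(q+1)q^{n-1} − (q+1)q^{n-2}` characters trivial on `F_v^×` and on
`U_E^n` but not on `U_E^{n-1}`. -/
theorem ncard_conjugateOrthogonal_exact {n : ℕ} (hn : 2 ≤ n) :
    {χ : (adicCompletion L w)ˣ →* ℂˣ | (∀ y ∈ (T5UnramifiedCharacter.baseUnits v w).range ⊔
      (higherUnits (algebraMap (adicCompletionIntegers K v) (adicCompletionIntegers L w) ϖ) n).map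
        (Units.map (algebraMap (adicCompletionIntegers L w) (adicCompletion L w) :
          adicCompletionIntegers L w →* adicCompletion L w)), χ y = 1) ∧
      ¬ ∀ y ∈ (T5UnramifiedCharacter.baseUnits v w).range ⊔
      (higherUnits (algebraMap (adicCompletionIntegers K v) (adicCompletionIntegers L w) ϖ)
        (n - 1)).map
        (Units.map (algebraMap (adicCompletionIntegers L w) (adicCompletion L w) :
          adicCompletionIntegers L w →* adicCompletion L w)), χ y = 1}.ncard =
      (q + 1) * q ^ (n - 1) - (q + 1) * q ^ (n - 2) := by
  have h1 := index_range_baseUnits_sup_map_higherUnits_of_inert v w hϖ hϖL (n := n) (by omega) hq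
    hk hku hK hKu
  have h2 := index_range_baseUnits_sup_map_higherUnits_of_inert v w hϖ hϖL (n := n - 1) (by omega)
    hq hk hku hK hKu
  rw [ncard_setOf_eq_one_on_and_not (range_sup_map_higherUnits_antitone v w ϖ (by omega))
    (by rw [h1]; positivity), h1, h2]
  congr 2

/-- CONDUCTOR EXACTLY `1`: exactly `q` characters (the `q` conjugate-symplectic characters of
conductor `1` of Lemma N5.L4(iii) are their `μ`-twists). -/
theorem ncard_conjugateOrthogonal_exact_one :
    {χ : (adicCompletion L w)ˣ →* ℂˣ | (∀ y ∈ (T5UnramifiedCharacter.baseUnits v w).range ⊔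
      (higherUnits (algebraMap (adicCompletionIntegers K v) (adicCompletionIntegers L w) ϖ) 1).map
        (Units.map (algebraMap (adicCompletionIntegers L w) (adicCompletion L w) :
          adicCompletionIntegers L w →* adicCompletion L w)), χ y = 1) ∧
      ¬ ∀ y ∈ (T5UnramifiedCharacter.baseUnits v w).range ⊔
      (higherUnits (algebraMap (adicCompletionIntegers K v) (adicCompletionIntegers L w) ϖ) 0).map
        (Units.map (algebraMap (adicCompletionIntegers L w) (adicCompletion L w) :
          adicCompletionIntegers L w →* adicCompletion L w)), χ y = 1}.ncard = q := by
  have h1 := index_range_baseUnits_sup_map_higherUnits_of_inert v w hϖ hϖL (n := 1) le_rfl hq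
    hk hku hK hKu
  have h0 := index_range_sup_map_higherUnits_zero_of_inert v w hϖ hϖL
  rw [ncard_setOf_eq_one_on_and_not (range_sup_map_higherUnits_antitone v w ϖ zero_le_one)
    (by rw [h1]; positivity), h1, h0]
  simp

/-- CONDUCTOR EXACTLY `2`: exactly `(q+1)(q−1)` characters. -/
theorem ncard_conjugateOrthogonal_exact_two :
    {χ : (adicCompletion L w)ˣ →* ℂˣ | (∀ y ∈ (T5UnramifiedCharacter.baseUnits v w).range ⊔
      (higherUnits (algebraMap (adicCompletionIntegers K v) (adicCompletionIntegers L w) ϖ) 2).map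
        (Units.map (algebraMap (adicCompletionIntegers L w) (adicCompletion L w) :
          adicCompletionIntegers L w →* adicCompletion L w)), χ y = 1) ∧
      ¬ ∀ y ∈ (T5UnramifiedCharacter.baseUnits v w).range ⊔
      (higherUnits (algebraMap (adicCompletionIntegers K v) (adicCompletionIntegers L w) ϖ) 1).map
        (Units.map (algebraMap (adicCompletionIntegers L w) (adicCompletion L w) :
          adicCompletionIntegers L w →* adicCompletion L w)), χ y = 1}.ncard =
      (q + 1) * (q - 1) := by
  have h2 := index_range_baseUnits_sup_map_higherUnits_of_inert v w hϖ hϖL (n := 2) (by norm_num)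
    hq hk hku hK hKu
  have h1 := index_range_baseUnits_sup_map_higherUnits_of_inert v w hϖ hϖL (n := 1) le_rfl hq
    hk hku hK hKu
  rw [ncard_setOf_eq_one_on_and_not (range_sup_map_higherUnits_antitone v w ϖ one_le_two)
    (by rw [h2]; positivity), h2, h1]
  have : 1 ≤ q := by omega
  rw [show (2 : ℕ) - 1 = 1 from rfl, show (1 : ℕ) - 1 = 0 from rfl, pow_one, pow_zero, mul_one,
    ← Nat.mul_sub_one]

end Counts

end Summit.Ventures.HodgeRepro2.T5InertCharacterCount
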